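import Mathlib
import Summits.Ventures.PercRepro2.UnionPASepDefs
import Summits.Ventures.PercRepro2.MergedUnionPairDefs
import Summits.Ventures.PercRepro2.MergedUnionPairBHK
import Summits.Ventures.PercRepro2.MergedUnionReduce

/-!
# (UNION-PA): the union-conditioned pair law is positively associated
(blind cell PercRepro2, mine-1 g34)

**Theorem** (`union_pa`). For every finite graph, vertices `s ≠ t`, vertex sets `X, Y`, every
admissible weight vector, and `F, G : 2^V × 2^V → [0, M]` increasing in the first and decreasing
in the second argument, with `Q = {s ↮ t} ∩ ({s ↮ X} ∪ {t ↮ Y})`,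

  `E[F(C_s,C_t) 1_Q] · E[G(C_s,C_t) 1_Q] ≤ E[(F G)(C_s,C_t) 1_Q] · P(Q)`:

conditionally on `s ↮ t` and the union event, the pair `(C_s, V ∖ C_t)` is positively associated
— the PA half of row 2′CON-U, for the plain clusters, with no separation hypothesis.

Proof = `pair_bhk_induced` (BHK06 Theorem 1.1 for the pair `(C_t, T*)` on the ghost graph,
`U = V`, avoided set `{s}`) giving **(PAIR-t)** (`pair_pa`, `pair_pa_anti`), then the reduction
`union_pa_of_pair` (conditional independence of `C_s` and `C_t` given `T*`).
-/

namespace Summit.Ventures.PercRepro2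

namespace MergedU

section Theorem

variable {V : Type*} {E : Type*} [Fintype E] [DecidableEq E] [Fintype V] [DecidableEq V]
  {R : Type*} [Field R] [LinearOrder R] [IsStrictOrderedRing R] [Archimedean R]

omit [Fintype E] [DecidableEq E] in
/-- On the whole graph the merged cluster in `G[V]` is the merged cluster. -/
lemma mergedIn_univ (ends : E → Sym2 V) (t : V) (Y X : Finset V) (ω : Config E) :
    mergedIn ends Finset.univ t Y X ω = merged ends ω t (↑Y) (↑X) := by
  simp only [mergedIn, Finset.coe_univ, induced_univ, Finset.inter_univ]

omit [Fintype E] [DecidableEq E] in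
/-- The avoidance event `{T* ∩ {s} = ∅}` on the whole graph. -/
lemma RmEvent_univ_singleton (ends : E → Sym2 V) (s t : V) (Y X : Finset V) :
    RmEvent ends Finset.univ t Y X {s} = {ω : Config E | s ∉ merged ends ω t (↑Y) (↑X)} := by
  ext ω
  simp only [mem_RmEvent, Finset.mem_singleton, forall_eq, Set.mem_setOf_eq, mergedIn_univ]

omit [Fintype E] [DecidableEq E] [Fintype V] [DecidableEq V] in
/-- `{s ∉ T*} = {s ↮ t} ∩ ({s ↮ X} ∪ {t ↮ Y})`: the conditioning event in the cell's vocabulary. -/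
lemma setOf_notMem_merged_eq (ends : E → Sym2 V) (s t : V) (X Y : Finset V) :
    {ω : Config E | s ∉ merged ends ω t (↑Y) (↑X)} =
      (connEvent ends s t)ᶜ ∩ UnionSep.unionEvent ends s t X Y := by
  ext ω
  simp only [Set.mem_setOf_eq, Set.mem_inter_iff, Set.mem_compl_iff, mem_connEvent,
    UnionSep.unionEvent, Set.mem_union, avoidAll, mem_merged, Finset.mem_coe, not_or, not_and]
  constructor
  · rintro ⟨hts, h⟩
    refine ⟨fun hst => hts (conn_symm hst), ?_⟩
    by_cases hY : ∃ y ∈ Y, Conn ends ω t y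
    · left
      intro x hx hsx
      exact h hY ⟨x, hx, conn_symm hsx⟩
    · right
      intro y hy hty
      exact hY ⟨y, hy, hty⟩
  · rintro ⟨hst, h⟩
    refine ⟨fun hts => hst (conn_symm hts), fun hY hX => ?_⟩
    obtain ⟨x, hx, hxs⟩ := hX
    obtain ⟨y, hy, hty⟩ := hY
    rcases h with h | h
    · exact h x hx (conn_symm hxs)
    · exact h y hy hty

omit [Archimedean R] in
/-- **(PAIR-t)**: the pair `(C_t, T*)` is positively associated under `P(· | s ∉ T*)` — for
`Φ₁, Φ₂` nonnegative and monotone in both arguments. -/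
theorem pair_pa {p : E → R} (hp : IsProbVec p) (ends : E → Sym2 V) (s t : V) (X Y : Finset V)
    {Φ₁ Φ₂ : Set V → Set V → R}
    (hΦ₁ : ∀ ⦃C C' D D' : Set V⦄, C ⊆ C' → D ⊆ D' → Φ₁ C D ≤ Φ₁ C' D')
    (hΦ₂ : ∀ ⦃C C' D D' : Set V⦄, C ⊆ C' → D ⊆ D' → Φ₂ C D ≤ Φ₂ C' D')
    (hΦ₁0 : ∀ C D, 0 ≤ Φ₁ C D) (hΦ₂0 : ∀ C D, 0 ≤ Φ₂ C D) :
    expect p (fun ω => Φ₁ (cluster ends ω t) (merged ends ω t (↑Y) (↑X)) *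
        ({ω : Config E | s ∉ merged ends ω t (↑Y) (↑X)}).indicator 1 ω) *
      expect p (fun ω => Φ₂ (cluster ends ω t) (merged ends ω t (↑Y) (↑X)) *
        ({ω : Config E | s ∉ merged ends ω t (↑Y) (↑X)}).indicator 1 ω) ≤
    expect p (fun ω => Φ₁ (cluster ends ω t) (merged ends ω t (↑Y) (↑X)) *
        Φ₂ (cluster ends ω t) (merged ends ω t (↑Y) (↑X)) *
        ({ω : Config E | s ∉ merged ends ω t (↑Y) (↑X)}).indicator 1 ω) *
      prob p {ω : Config E | s ∉ merged ends ω t (↑Y) (↑X)} := by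
  have key := pair_bhk_induced p hp ends t hΦ₁ hΦ₂ hΦ₁0 hΦ₂0 Finset.univ Y X {s} {s}
    (Finset.subset_univ _) (Finset.subset_univ _)
  simp only [Finset.inter_self, Finset.union_self, RmEvent_univ_singleton] at key
  have e : ∀ Φ : Set V → Set V → R, pairObs ends Finset.univ t Y X Φ =
      fun ω => Φ (cluster ends ω t) (merged ends ω t (↑Y) (↑X)) := by
    intro Φ
    funext ω
    simp only [pairObs, clusterIn_univ, mergedIn_univ]
  simp only [e] at key
  exact key

omit [Archimedean R] in
/-- **(PAIR-t) for antitone functionals** (the form used by `union_pa_of_pair`): for `Φ, Ψ`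
antitone in both arguments with `0 ≤ Φ, Ψ ≤ M'`. -/
theorem pair_pa_anti {p : E → R} (hp : IsProbVec p) (ends : E → Sym2 V) (s t : V)
    (X Y : Finset V) (Φ Ψ : Set V → Set V → R) (M' : R)
    (hΦ : ∀ ⦃D₀ D₀' D D' : Set V⦄, D₀ ⊆ D₀' → D ⊆ D' → Φ D₀' D' ≤ Φ D₀ D)
    (hΨ : ∀ ⦃D₀ D₀' D D' : Set V⦄, D₀ ⊆ D₀' → D ⊆ D' → Ψ D₀' D' ≤ Ψ D₀ D)
    (_hΦ0 : ∀ D₀ D, 0 ≤ Φ D₀ D) (_hΨ0 : ∀ D₀ D, 0 ≤ Ψ D₀ D) (hΦM : ∀ D₀ D, Φ D₀ D ≤ M')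
    (hΨM : ∀ D₀ D, Ψ D₀ D ≤ M') :
    expect p (fun ω => Φ (cluster ends ω t) (merged ends ω t (↑Y) (↑X)) *
        ({ω : Config E | s ∉ merged ends ω t (↑Y) (↑X)}).indicator 1 ω) *
      expect p (fun ω => Ψ (cluster ends ω t) (merged ends ω t (↑Y) (↑X)) *
        ({ω : Config E | s ∉ merged ends ω t (↑Y) (↑X)}).indicator 1 ω) ≤
    expect p (fun ω => Φ (cluster ends ω t) (merged ends ω t (↑Y) (↑X)) *
        Ψ (cluster ends ω t) (merged ends ω t (↑Y) (↑X)) *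
        ({ω : Config E | s ∉ merged ends ω t (↑Y) (↑X)}).indicator 1 ω) *
      prob p {ω : Config E | s ∉ merged ends ω t (↑Y) (↑X)} := by
  set Q : Set (Config E) := {ω : Config E | s ∉ merged ends ω t (↑Y) (↑X)} with hQ
  -- apply `pair_pa` to `M' − Φ`, `M' − Ψ`
  have key := pair_pa hp ends s t X Y (Φ₁ := fun C D => M' - Φ C D) (Φ₂ := fun C D => M' - Ψ C D)
    (fun _ _ _ _ h₀ h => by linarith [hΦ h₀ h])
    (fun _ _ _ _ h₀ h => by linarith [hΨ h₀ h])
    (fun C D => by linarith [hΦM C D]) (fun C D => by linarith [hΨM C D])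
  rw [← hQ] at key
  -- expand the four expectations
  set a := expect p (fun ω => Φ (cluster ends ω t) (merged ends ω t (↑Y) (↑X)) * Q.indicator 1 ω)
    with ha
  set b := expect p (fun ω => Ψ (cluster ends ω t) (merged ends ω t (↑Y) (↑X)) * Q.indicator 1 ω)
    with hb
  set c := expect p (fun ω => Φ (cluster ends ω t) (merged ends ω t (↑Y) (↑X)) *
    Ψ (cluster ends ω t) (merged ends ω t (↑Y) (↑X)) * Q.indicator 1 ω) with hc
  set Z := prob p Q with hZ
  have eZ : expect p (fun ω => Q.indicator (1 : Config E → R) ω) = Z := by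
    rw [hZ, prob_eq_expect_indicator]
  have e1 : expect p (fun ω => (M' - Φ (cluster ends ω t) (merged ends ω t (↑Y) (↑X))) *
      Q.indicator 1 ω) = M' * Z - a := by
    have : (fun ω => (M' - Φ (cluster ends ω t) (merged ends ω t (↑Y) (↑X))) *
        Q.indicator (1 : Config E → R) ω) =
        (fun ω => M' * Q.indicator (1 : Config E → R) ω) -
          (fun ω => Φ (cluster ends ω t) (merged ends ω t (↑Y) (↑X)) * Q.indicator 1 ω) := by
      funext ω; simp only [Pi.sub_apply]; ring
    rw [this, expect_sub, expect_const_mul, eZ]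
  have e2 : expect p (fun ω => (M' - Ψ (cluster ends ω t) (merged ends ω t (↑Y) (↑X))) *
      Q.indicator 1 ω) = M' * Z - b := by
    have : (fun ω => (M' - Ψ (cluster ends ω t) (merged ends ω t (↑Y) (↑X))) *
        Q.indicator (1 : Config E → R) ω) =
        (fun ω => M' * Q.indicator (1 : Config E → R) ω) -
          (fun ω => Ψ (cluster ends ω t) (merged ends ω t (↑Y) (↑X)) * Q.indicator 1 ω) := by
      funext ω; simp only [Pi.sub_apply]; ring
    rw [this, expect_sub, expect_const_mul, eZ]
  have e3 : expect p (fun ω => (M' - Φ (cluster ends ω t) (merged ends ω t (↑Y) (↑X))) *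
      (M' - Ψ (cluster ends ω t) (merged ends ω t (↑Y) (↑X))) * Q.indicator 1 ω) =
      M' * M' * Z - M' * a - M' * b + c := by
    have : (fun ω => (M' - Φ (cluster ends ω t) (merged ends ω t (↑Y) (↑X))) *
        (M' - Ψ (cluster ends ω t) (merged ends ω t (↑Y) (↑X))) * Q.indicator (1 : Config E → R) ω) =
        ((fun ω => (M' * M') * Q.indicator (1 : Config E → R) ω) -
          (fun ω => M' * (Φ (cluster ends ω t) (merged ends ω t (↑Y) (↑X)) * Q.indicator 1 ω))) -
          (fun ω => M' * (Ψ (cluster ends ω t) (merged ends ω t (↑Y) (↑X)) * Q.indicator 1 ω)) +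
          (fun ω => Φ (cluster ends ω t) (merged ends ω t (↑Y) (↑X)) *
            Ψ (cluster ends ω t) (merged ends ω t (↑Y) (↑X)) * Q.indicator 1 ω) := by
      funext ω; simp only [Pi.sub_apply, Pi.add_apply]; ring
    rw [this, expect_add, expect_sub, expect_sub, expect_const_mul, expect_const_mul,
      expect_const_mul, eZ]
  rw [e1, e2, e3] at key
  have e : (M' * M' * Z - M' * a - M' * b + c) * Z - (M' * Z - a) * (M' * Z - b) = c * Z - a * b := by
    ring
  linarith

omit [Archimedean R] in
/-- **(UNION-PA) — THEOREM.** For `F, G : 2^V × 2^V → [0, M]` increasing in `C_s` and decreasing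
in `C_t`, and `Q = {s ↮ t} ∩ ({s ↮ X} ∪ {t ↮ Y})`,
`E[F(C_s,C_t) 1_Q] · E[G(C_s,C_t) 1_Q] ≤ E[(F G)(C_s,C_t) 1_Q] · P(Q)`: conditionally on `s ↮ t`
and the union event, the pair `(C_s, V ∖ C_t)` is positively associated. -/
theorem union_pa {p : E → R} (hp : IsProbVec p) (ends : E → Sym2 V) (s t : V) (X Y : Finset V)
    {F G : Set V → Set V → R}
    (hF : ∀ ⦃W W' C C' : Set V⦄, W ⊆ W' → C' ⊆ C → F W C ≤ F W' C')
    (hG : ∀ ⦃W W' C C' : Set V⦄, W ⊆ W' → C' ⊆ C → G W C ≤ G W' C')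
    (hF0 : ∀ W C, 0 ≤ F W C) (hG0 : ∀ W C, 0 ≤ G W C) {M : R} (hFM : ∀ W C, F W C ≤ M)
    (hGM : ∀ W C, G W C ≤ M) :
    expect p (fun ω => F (cluster ends ω s) (cluster ends ω t) *
        ((connEvent ends s t)ᶜ ∩ UnionSep.unionEvent ends s t X Y).indicator 1 ω) *
      expect p (fun ω => G (cluster ends ω s) (cluster ends ω t) *
        ((connEvent ends s t)ᶜ ∩ UnionSep.unionEvent ends s t X Y).indicator 1 ω) ≤
    expect p (fun ω => F (cluster ends ω s) (cluster ends ω t) *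
        G (cluster ends ω s) (cluster ends ω t) *
        ((connEvent ends s t)ᶜ ∩ UnionSep.unionEvent ends s t X Y).indicator 1 ω) *
      prob p ((connEvent ends s t)ᶜ ∩ UnionSep.unionEvent ends s t X Y) := by
  rw [← setOf_notMem_merged_eq ends s t X Y]
  exact union_pa_of_pair ends s t (↑X) (↑Y) hp
    (fun Φ Ψ M' hΦ hΨ hΦ0 hΨ0 hΦM hΨM => pair_pa_anti hp ends s t X Y Φ Ψ M' hΦ hΨ hΦ0 hΨ0 hΦM hΨM)
    hF hG hF0 hG0 hFM hGM

end Theorem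

end MergedU

end Summit.Ventures.PercRepro2
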